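import Summits.NavierStokesRegularity.NavierStokesRegularity.Theorems.TerminalTraceTypeITraceScarL3QuietShellAnnulusStep
import Summits.NavierStokesRegularity.NavierStokesRegularity.Theorems.TerminalTraceTypeITraceScarL3DepthGaussianLowerBound
import Literature.Analysis.FluidPDE.TypeIRateClassicalRepresentative
import Literature.Analysis.FluidPDE.TaoMainEstimateVorticityAnnulus
import Literature.Analysis.FluidPDE.TaoLocalVelocityGradient
import Literature.Analysis.FluidPDE.LocalTypeI
import HarnessLib

/-!
# Stub Q234 of line `annulus-dichotomy` FOLLOWS FROM THE WEAK SHELL DATA (continuity + four sup bounds +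
# curl → 0 at the top on the sub-shell; no joint C² in time, no uniform structure)
# (item `TerminalTrace.TypeITraceScarL3`, stmt-NavierStokesRegularity-18385; skeleton v4 3f7a14107033987a)

Seat ns-typeII-p3 g10 (cell ns-regularity-ideate), `--supports stmt-NavierStokesRegularity-18385` (helper; the
«whoever assembles Q4» slot of nsreg-p2 g28's ROAD C).  Companion of `quietShell_noConcentration_of_Q3`
(p595157) with the hypothesis WEAKENED to what the assembly actually consumes (and to what nsreg-C26-p1's Q3 plan
of 01:29:32Z produces — `ContDiffOn ℝ 2 (uncurry V)` in TIME is false in general and is not needed):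
`quietShell_noConcentration_of_shellData` proves the REGISTERED statement of `stub_quietShell_noConcentration`
(VERBATIM) from ONE displayed hypothesis `hQ3w`: a quiet shell of ratio `A₀ > 4` yields, for SOME `δ' > 0`, a
representative `V` on the sub-shell slab `]−δ',0[ × {2R < |y| < A₀R/2}` which is jointly CONTINUOUS, carries sup
bounds on `V, ∇V, curl V, ∇curl V`, and whose curl tends to `0` at the top in the explicit form
`∀ η > 0, ∃ s₀ < 0, ∀ s ∈ ]s₀, 0[, ∀ y ∈ sub-shell, ‖curl V(s) y‖ ≤ η`.  Everything else is a tree theorem: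
* the classical representative `v` of the apex package (`exists_classical_repr_of_apexPackage`, typer g20);
* UNIFORM regularity at depth and Tao's (5.7) at depth (`exists_depth_gaussian_lower_bound`, p594213);
* Tao's annulus bound (5.17) (`IsClassicalNSSolutionOn.vorticity_annulus_lower_bound`);
* the zero-data squeeze (`false_of_quietShell_concentration`, p594736).
The ratio is `A₀ := 6Λ + 4`, `Λ := max(Λ₀, 8(2·10¹⁷E/θ + 4√(5·10¹²)/(θκ₀)))` — class data only.

When a prover lands `hQ3w` (nsreg-C26-p1's Q3 in its natural shape), the registered stub follows by modus ponens.
WHAT THIS IS NOT: not Q3, not Q1, not LOUD, not NS regularity — the conditional Carleman half of the cut.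
[cite: Tao2021QuantitativeNS, Thm. 5.1 proof pp. 37–40 (5.7)–(5.17)]
-/

noncomputable section

set_option linter.dupNamespace false

namespace Summit.NavierStokesRegularity.NavierStokesRegularity.Theorems.TypeITraceScarL3

open MeasureTheory Set Function Filter Topology Metric
open Literature.Analysis.FluidPDE
open scoped NNReal ENNReal InnerProductSpace RealInnerProductSpace

/-- **Q234 ⇐ weak shell data**: the registered statement of `stub_quietShell_noConcentration` (skeleton v4,
verbatim) under the hypothesis `hQ3w` (continuous representative on the sub-shell slab for some `δ' > 0`, four sup
bounds, `curl V → 0` at the top in `ε`–`s₀` form). [cite: Tao2021QuantitativeNS, Thm. 5.1 proof pp. 37–40] -/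
theorem quietShell_noConcentration_of_shellData
    (hQ3w : ∀ (M D₀ : ℝ≥0) (C : ℝ) (U : ℝ → EuclideanSpace ℝ (Fin 3) → EuclideanSpace ℝ (Fin 3)) (P : ℝ → EuclideanSpace ℝ (Fin 3) → ℝ)
      (G : ℝ → EuclideanSpace ℝ (Fin 3) → EuclideanSpace ℝ (Fin 3) →L[ℝ] EuclideanSpace ℝ (Fin 3)),
      (∀ a : ℝ, 0 < a → IsSuitableWeakSolutionInBall a (0 : ℝ × EuclideanSpace ℝ (Fin 3)) U P) →
      (∀ a : ℝ, 0 < a → HasWeakSpatialGradientOn (parabolicCylinderOpens a (0 : ℝ × EuclideanSpace ℝ (Fin 3))) U G) →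
      (∀ a : ℝ, 0 < a → typeIBound (parabolicCylinder a (0 : ℝ × EuclideanSpace ℝ (Fin 3))) U P G ≤ M) →
      (∀ z₀ : ℝ × EuclideanSpace ℝ (Fin 3), z₀.1 ≤ 0 → ∀ r : ℝ, 0 < r → cknD r z₀ P ≤ D₀) →
      (∀ s : ℝ, s < 0 → ∀ᵐ y : EuclideanSpace ℝ (Fin 3), ‖U s y‖ ≤ C / Real.sqrt (-s)) →
      (∀ φ : EuclideanSpace ℝ (Fin 3) → EuclideanSpace ℝ (Fin 3), ContDiff ℝ (⊤ : ℕ∞) φ → HasCompactSupport φ → ∀ ε : ℝ, 0 < ε →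
        ∃ s₀ : ℝ, s₀ < 0 ∧ ∀ᵐ s ∂(volume.restrict (Ioo s₀ 0)), |∫ y, ⟪U s y, φ y⟫| ≤ ε) →
      ∀ (δ R A₀ K : ℝ), 0 < δ → 0 < R → 4 < A₀ →
        (∀ᵐ z ∂(volume.restrict (Ioo (-δ) 0 ×ˢ {y : EuclideanSpace ℝ (Fin 3) | R < ‖y‖ ∧ ‖y‖ < A₀ * R})),
          ‖U z.1 z.2‖ ≤ K) →
        ∃ δ' : ℝ, 0 < δ' ∧ ∃ V : ℝ → EuclideanSpace ℝ (Fin 3) → EuclideanSpace ℝ (Fin 3),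
          uncurry V =ᵐ[volume.restrict
            (Ioo (-δ') 0 ×ˢ {y : EuclideanSpace ℝ (Fin 3) | 2 * R < ‖y‖ ∧ ‖y‖ < A₀ * R / 2})] uncurry U ∧
          ContinuousOn (uncurry V) (Ioo (-δ') 0 ×ˢ {y : EuclideanSpace ℝ (Fin 3) | 2 * R < ‖y‖ ∧ ‖y‖ < A₀ * R / 2}) ∧
          (∃ K' : ℝ, ∀ s ∈ Ioo (-δ') 0, ∀ y ∈ {y : EuclideanSpace ℝ (Fin 3) | 2 * R < ‖y‖ ∧ ‖y‖ < A₀ * R / 2},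
            ‖V s y‖ ≤ K' ∧ ‖fderiv ℝ (V s) y‖ ≤ K' ∧ ‖curl (V s) y‖ ≤ K' ∧
            ‖fderiv ℝ (curl (V s)) y‖ ≤ K') ∧
          (∀ η : ℝ, 0 < η → ∃ s₀ : ℝ, s₀ < 0 ∧ ∀ s ∈ Ioo s₀ 0,
            ∀ y ∈ {y : EuclideanSpace ℝ (Fin 3) | 2 * R < ‖y‖ ∧ ‖y‖ < A₀ * R / 2}, ‖curl (V s) y‖ ≤ η)) :
    ∀ (M D₀ : ℝ≥0) (C κ₀ c₂ : ℝ), 0 < κ₀ → 0 < c₂ → c₂ < 1 / 2 → ∃ A₀ : ℝ, 1 < A₀ ∧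
    ∀ (U : ℝ → EuclideanSpace ℝ (Fin 3) → EuclideanSpace ℝ (Fin 3))
      (P : ℝ → EuclideanSpace ℝ (Fin 3) → ℝ)
      (G : ℝ → EuclideanSpace ℝ (Fin 3) →
        EuclideanSpace ℝ (Fin 3) →L[ℝ] EuclideanSpace ℝ (Fin 3)),
      (∀ a : ℝ, 0 < a →
        IsSuitableWeakSolutionInBall a (0 : ℝ × EuclideanSpace ℝ (Fin 3)) U P) →
      (∀ a : ℝ, 0 < a →
        HasWeakSpatialGradientOn
          (parabolicCylinderOpens a (0 : ℝ × EuclideanSpace ℝ (Fin 3))) U G) →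
      (∀ a : ℝ, 0 < a →
        typeIBound (parabolicCylinder a (0 : ℝ × EuclideanSpace ℝ (Fin 3))) U P G ≤ M) →
      (∀ z₀ : ℝ × EuclideanSpace ℝ (Fin 3), z₀.1 ≤ 0 →
        ∀ r : ℝ, 0 < r → cknD r z₀ P ≤ D₀) →
      (∀ s : ℝ, s < 0 →
        ∀ᵐ y : EuclideanSpace ℝ (Fin 3), ‖U s y‖ ≤ C / Real.sqrt (-s)) →
      (∀ φ : EuclideanSpace ℝ (Fin 3) → EuclideanSpace ℝ (Fin 3),
        ContDiff ℝ (⊤ : ℕ∞) φ →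
        HasCompactSupport φ → ∀ ε : ℝ, 0 < ε →
        ∃ s₀ : ℝ, s₀ < 0 ∧ ∀ᵐ s ∂(volume.restrict (Ioo s₀ 0)), |∫ y, ⟪U s y, φ y⟫| ≤ ε) →
      (∃ δ : ℝ, 0 < δ ∧ ∃ R : ℝ, 0 < R ∧ ∃ K : ℝ,
        ∀ᵐ z ∂(volume.restrict
          (Ioo (-δ) 0 ×ˢ {y : EuclideanSpace ℝ (Fin 3) | R < ‖y‖ ∧ ‖y‖ < A₀ * R})),
            ‖U z.1 z.2‖ ≤ K) →
      ¬ (∀ T₁ : ℝ, 0 < T₁ → ∃ t₁ ∈ Icc (-T₁) (-T₁ / 2),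
        ∀ V : ℝ → EuclideanSpace ℝ (Fin 3) → EuclideanSpace ℝ (Fin 3),
          Function.uncurry V =ᵐ[volume.restrict
              (Ioo (-2 * T₁) (-T₁ / 4) ×ˢ (univ : Set (EuclideanSpace ℝ (Fin 3))))]
            Function.uncurry U →
          ContinuousOn (Function.uncurry V)
            (Ioo (-2 * T₁) (-T₁ / 4) ×ˢ (univ : Set (EuclideanSpace ℝ (Fin 3)))) →
          (∀ t ∈ Ioo (-2 * T₁) (-T₁ / 4), ContDiff ℝ 1 (V t)) →
          ∀ t ∈ Icc (t₁ - c₂ * T₁) t₁,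
            κ₀ * T₁ ^ (-(1 / 2 : ℝ)) ≤
              ∫ x in ball (0 : EuclideanSpace ℝ (Fin 3)) (Real.sqrt T₁), ‖curl (V t) x‖ ^ 2) := by
  intro M D₀ C κ₀ c₂ hκ₀ hc₂ _hc₂'
  -- ### the class constants
  obtain ⟨Λ₀, K, hΛ₀1, -, hAnn⟩ := IsClassicalNSSolutionOn.vorticity_annulus_lower_bound
  obtain ⟨θ, E, hθ, -, hθhalf, hE, hGauss⟩ := exists_depth_gaussian_lower_bound C D₀ hκ₀ hc₂
  obtain ⟨Λ, hΛdef⟩ : ∃ Λ : ℝ,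
      Λ = max Λ₀ (8 * (2 * 10 ^ 17 * E / θ + 4 * Real.sqrt (5 * 10 ^ 12) / (θ * κ₀))) := ⟨_, rfl⟩
  have hΛ₀ : Λ₀ ≤ Λ := by rw [hΛdef]; exact le_max_left _ _
  have hΛ : 8 * (2 * 10 ^ 17 * E / θ + 4 * Real.sqrt (5 * 10 ^ 12) / (θ * κ₀)) ≤ Λ := by
    rw [hΛdef]; exact le_max_right _ _
  have hΛ1 : 1 ≤ Λ := hΛ₀1.trans hΛ₀
  refine ⟨6 * Λ + 4, by linarith only [hΛ1], ?_⟩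
  intro U P G hsw hG hI hD hrate htop hQA hconc
  obtain ⟨δ, hδ, Rq, hRq, Kq, hquiet⟩ := hQA
  have hA₀4 : (4 : ℝ) < 6 * Λ + 4 := by linarith only [hΛ1]
  -- ### the quiet-shell representative (Q3)
  obtain ⟨δ', hδ', V, hVU, hVc0, ⟨K', hK'⟩, hcurl0⟩ :=
    hQ3w M D₀ C U P G hsw hG hI hD hrate htop δ Rq (6 * Λ + 4) Kq hδ hRq hA₀4 hquiet
  -- ### the classical representative of the apex package
  obtain ⟨v, hvU, hvc, hvrate, hvsm, -, -, -, hvcl⟩ := exists_classical_repr_of_apexPackage hsw hI hrate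
  have hvs : ∀ t < 0, ContDiff ℝ (⊤ : ℕ∞) (v t) := fun t ht => hvsm.contDiff_slice ht
  have hvrate' : ∀ t < 0, ∀ x : EuclideanSpace ℝ (Fin 3), ‖v t x‖ ≤ C / Real.sqrt (-t) := hvrate
  -- ### `V = v` on the open sub-shell slab
  have hShopen : IsOpen {y : EuclideanSpace ℝ (Fin 3) | 2 * Rq < ‖y‖ ∧ ‖y‖ < (6 * Λ + 4) * Rq / 2} :=
    (isOpen_lt continuous_const continuous_norm).inter (isOpen_lt continuous_norm continuous_const)
  have hSopen : IsOpen (Ioo (-δ') 0 ×ˢ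
      {y : EuclideanSpace ℝ (Fin 3) | 2 * Rq < ‖y‖ ∧ ‖y‖ < (6 * Λ + 4) * Rq / 2}) :=
    isOpen_Ioo.prod hShopen
  have hSsub : Ioo (-δ') 0 ×ˢ {y : EuclideanSpace ℝ (Fin 3) | 2 * Rq < ‖y‖ ∧ ‖y‖ < (6 * Λ + 4) * Rq / 2} ⊆
      Iio (0 : ℝ) ×ˢ (univ : Set (EuclideanSpace ℝ (Fin 3))) :=
    prod_mono (fun s hs => hs.2) (subset_univ _)
  have hVv : EqOn (uncurry V) (uncurry v)
      (Ioo (-δ') 0 ×ˢ {y : EuclideanSpace ℝ (Fin 3) | 2 * Rq < ‖y‖ ∧ ‖y‖ < (6 * Λ + 4) * Rq / 2}) := by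
    have hUv : uncurry U =ᵐ[volume.restrict (Ioo (-δ') 0 ×ˢ
        {y : EuclideanSpace ℝ (Fin 3) | 2 * Rq < ‖y‖ ∧ ‖y‖ < (6 * Λ + 4) * Rq / 2})] uncurry v :=
      ae_restrict_of_ae_restrict_of_subset hSsub hvU
    exact Measure.eqOn_open_of_ae_eq (hVU.trans hUv) hSopen hVc0 (hvc.mono hSsub)
  -- slices: `V t = v t` near every point of the shell, for `t ∈ ]−δ/2, 0[`
  have hslice : ∀ t ∈ Ioo (-δ') 0, ∀ x ∈ {y : EuclideanSpace ℝ (Fin 3) |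
      2 * Rq < ‖y‖ ∧ ‖y‖ < (6 * Λ + 4) * Rq / 2}, V t =ᶠ[𝓝 x] v t := by
    intro t ht x hx
    filter_upwards [hShopen.mem_nhds hx] with y hy
    exact hVv (mk_mem_prod ht hy)
  -- ### the shell data for `v` with `R_a = 3 Rq`: `[3Rq, 3ΛRq] ⊆ ]2Rq, (3Λ+2)Rq[`
  have hshell : ∀ t ∈ Ioo (-δ') 0, ∀ x : EuclideanSpace ℝ (Fin 3), 3 * Rq ≤ ‖x‖ → ‖x‖ ≤ Λ * (3 * Rq) →
      ‖v t x‖ ≤ K' ∧ ‖fderiv ℝ (v t) x‖ ≤ K' ∧ ‖vorticity v t x‖ ≤ K' ∧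
      ‖fderiv ℝ (vorticity v t) x‖ ≤ K' := by
    intro t ht x hx1 hx2
    have ht' : t ∈ Ioo (-δ') 0 := ht
    have hxS : x ∈ {y : EuclideanSpace ℝ (Fin 3) | 2 * Rq < ‖y‖ ∧ ‖y‖ < (6 * Λ + 4) * Rq / 2} :=
      ⟨by linarith only [hx1, hRq], by nlinarith only [hx2, hRq, hΛ1]⟩
    obtain ⟨h1, h2, h3, h4⟩ := hK' t ht' x hxS
    have heq : V t =ᶠ[𝓝 x] v t := hslice t ht' x hxS
    have hpt : v t x = V t x := (heq.self_of_nhds).symm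
    have hfd : fderiv ℝ (v t) x = fderiv ℝ (V t) x := heq.symm.fderiv_eq
    have hcurl_near : curl (V t) =ᶠ[𝓝 x] curl (v t) := by
      have hopen := hShopen.mem_nhds hxS
      filter_upwards [eventually_eventuallyEq_nhds.2 heq] with y hy
      exact curl_congr_of_eventuallyEq hy
    have hcurl : vorticity v t x = curl (V t) x := (curl_congr_of_eventuallyEq heq).symm
    have hfdcurl : fderiv ℝ (vorticity v t) x = fderiv ℝ (curl (V t)) x := by
      show fderiv ℝ (curl (v t)) x = fderiv ℝ (curl (V t)) x
      exact hcurl_near.symm.fderiv_eq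
    refine ⟨by rw [hpt]; exact h1, by rw [hfd]; exact h2, by rw [hcurl]; exact h3, by rw [hfdcurl]; exact h4⟩
  -- ### the vorticity of `v` vanishes uniformly on `{6Rq ≤ |x| ≤ (3Λ/2) Rq}` as `t → 0⁻`
  have hω0 : ∀ η : ℝ, 0 < η → ∃ s₀ : ℝ, s₀ < 0 ∧ ∀ s ∈ Ioo s₀ 0, ∀ x : EuclideanSpace ℝ (Fin 3),
      2 * (3 * Rq) ≤ ‖x‖ → ‖x‖ ≤ Λ * (3 * Rq) / 2 → ‖vorticity v s x‖ ≤ η := by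
    intro η hη
    obtain ⟨l, hl, hlb⟩ := hcurl0 η hη
    refine ⟨max l (-δ'), max_lt hl (by linarith only [hδ']), fun s hs x hx1 hx2 => ?_⟩
    have hsl : s ∈ Ioo l 0 := ⟨lt_of_le_of_lt (le_max_left _ _) hs.1, hs.2⟩
    have hsδ : s ∈ Ioo (-δ') 0 := ⟨lt_of_le_of_lt (le_max_right _ _) hs.1, hs.2⟩
    have hxS : x ∈ {y : EuclideanSpace ℝ (Fin 3) | 2 * Rq < ‖y‖ ∧ ‖y‖ < (6 * Λ + 4) * Rq / 2} :=
      ⟨by linarith only [hx1, hRq], by nlinarith only [hx2, hRq, hΛ1]⟩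
    have h2 := hlb s hsl x hxS
    have hcurl : vorticity v s x = curl (V s) x := (curl_congr_of_eventuallyEq (hslice s hsδ x hxS)).symm
    rw [hcurl]
    exact h2
  -- ### Q1 for `v`
  have hconc_v : ∀ T₁ : ℝ, 0 < T₁ → ∃ t₁ ∈ Icc (-T₁) (-T₁ / 2), ∀ t ∈ Icc (t₁ - c₂ * T₁) t₁,
      κ₀ * T₁ ^ (-(1 / 2 : ℝ)) ≤
        ∫ x in ball (0 : EuclideanSpace ℝ (Fin 3)) (Real.sqrt T₁), ‖curl (v t) x‖ ^ 2 := by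
    intro T₁ hT₁
    obtain ⟨t₁, ht₁, h⟩ := hconc T₁ hT₁
    refine ⟨t₁, ht₁, h v ?_ ?_ ?_⟩
    · have hsub : Ioo (-2 * T₁) (-T₁ / 4) ×ˢ (univ : Set (EuclideanSpace ℝ (Fin 3))) ⊆
          Iio (0 : ℝ) ×ˢ (univ : Set (EuclideanSpace ℝ (Fin 3))) :=
        prod_mono (fun s hs => lt_of_lt_of_le hs.2 (by linarith only [hT₁])) Subset.rfl
      have h1 : ∀ᵐ w ∂(volume.restrict (Ioo (-2 * T₁) (-T₁ / 4) ×ˢ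
          (univ : Set (EuclideanSpace ℝ (Fin 3))))), uncurry U w = uncurry v w :=
        ae_restrict_of_ae_restrict_of_subset hsub hvU
      filter_upwards [h1] with w hw
      exact hw.symm
    · exact hvc.mono (prod_mono (fun s hs => lt_of_lt_of_le hs.2 (by linarith only [hT₁])) Subset.rfl)
    · intro t ht
      exact (hvs t (lt_of_lt_of_le ht.2 (by linarith only [hT₁]))).of_le (by norm_cast)
  -- ### the squeeze
  exact false_of_quietShell_concentration hAnn hθ hθhalf hE hκ₀
    (hGauss U P hsw hD hrate v hvU hvc hvs hvrate' hvcl) hconc_v hvcl hΛ₀ hΛ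
    (δ' := δ') (R_a := 3 * Rq) (K' := K') hδ' (by positivity) hshell hω0

end Summit.NavierStokesRegularity.NavierStokesRegularity.Theorems.TypeITraceScarL3

end
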